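import Summits.ValiantsHypothesis.ValiantsHypothesis.Theorems.LacunarySymmetroidMatrixDescartesGraftLaw
import Summits.ValiantsHypothesis.ValiantsHypothesis.Theorems.LacunarySymmetroidMatrixDescartesGraftBilinear
import Summits.ValiantsHypothesis.ValiantsHypothesis.Theorems.KPlusLogSqLawSymmetricDesigns

/-!
# Route «KPlusLogSqLaw» — SYMMETRIC DESIGNS GRAFT: a symmetric dominance design with `B` alternations gives the whole
# rightward RAY of real census floors `ζ₊sym(m, K + j) ≥ B + j·m`

HONEST FRAMING.  Helper file (seat typer (g11), cell `pub-symmetroid`, 2026-08-27; `--supports` the `WeakLifting` item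
stmt-ValiantsHypothesis-19561 as a helper, no closure claim).  Pure lemma file, no definitions.  LOWER-bound / construction
mathematics in census currency: it composes two tools already in the tree and proves nothing about the cruxes `TropicalB` /
`WeakLifting` / `MatrixDescartes` (stmt-ValiantsHypothesis-18050; an UPPER bound at fat formats), nothing about the Door-A numerals
`PosRootLawAt 2 6 19` / `PosRootLawAt 3 4 18` (OPEN, typed, never asserted), and nothing about `VP ≠ VNP`; a lower census bound
refutes no law of record.

THE TWO TOOLS.  (1) Symmetric patchworking (`TropicalCensus.patchMatrix_isSymm`, `MatrixDescartes.Negative.det_patch_sign`,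
`det_patch_alternates`): a SYMMETRIC design `(v, ε)` on exponents `d` with `B + 1` uniquely dominant Leibniz terms of alternating
`termSign` at strictly increasing integer slopes `θ₀ < ⋯ < θ_B` patchworks, at base `b = #terms + 1`, to the real SYMMETRIC `K`-term
`m × m` pencil `patchMatrix b v ε` whose determinant is nonzero with alternating signs at the positive test points `b^θ_k`
— an ALTERNATION CERTIFICATE with `B` alternations (`exists_alternating_of_symmDesign`, exactly the hypothesis shape of the graft law).
(2) THE GRAFT LAW (`Census.Graft.exists_alternating_add`, seat val-sym-mdr-p1 (g3)): from any alternation certificate of a real symmetric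
`K`-term pencil, `j` further letters buy `j·m` further alternations.
COMPOSITION (`not_posRootLawAt_add_of_symmDesign`, and the packaged form `not_posRootLawAt_add_of_symmDesign_row` taking a design row
literally in the shape the tree's design theorems state it): **`¬ PosRootLawAt m (K + j) (B + j·m − 1)` for every `j`** — every
symmetric tropical design row in the kernel yields its whole rightward ray of real census floors; `j = 0` is the contrapositive of
`TropicalCensus.symmDesign_le_of_posRootLawAt`.  [folklore] (Viro patchworking; spectral theorem / intermediate value theorem inside
the graft law).
APPEND (typer g11, same day).  THE QUADRANT: fed instead to the BILINEAR LAW (`Census.Graft.not_posRootLawAt_bilinear`, seat val-sym-mdr-p1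
(g3): `i` more rows/columns buy `i·(#letters − 1)` alternations, then `j` more letters buy `j·(m + i)`), a symmetric design of format
`(m, K + 1)` with `B ≥ 1` alternations gives **`¬ PosRootLawAt (m + i) (K + 1 + j) (B + i·K + j·(m + i) − 1)` for all `i, j`**
(`not_posRootLawAt_bilinear_of_symmDesign`, row form `not_posRootLawAt_bilinear_of_symmDesign_row`).  [folklore]
-/

-- `Summit.ValiantsHypothesis.ValiantsHypothesis.…` repeats a component by the D-0017 layout
-- (single-conjunct summit), which the `dupNamespace` linter flags; the name is mandated.
set_option linter.dupNamespace false
set_option autoImplicit false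

namespace Summit.ValiantsHypothesis.ValiantsHypothesis.Theorems.LacunarySymmetroidMatrixDescartes.TropicalCensus

open Summit.ValiantsHypothesis.ValiantsHypothesis.Theorems.MatrixDescartes.Negative
open Summit.ValiantsHypothesis.ValiantsHypothesis.Theorems.LacunarySymmetroidMatrixDescartes
open scoped BigOperators

variable {m K : ℕ}

/-- **A symmetric design is an alternation certificate.**  A SYMMETRIC design (symmetric valuations `v` and signs `ε`, `|ε| ≤ 1`)
on exponents `d` with `B + 1` uniquely dominant terms of alternating sign at strictly increasing integer slopes gives a real
SYMMETRIC `K`-term `m × m` pencil (the patchworked pencil `patchMatrix b v ε`, `b = #terms + 1`) and `B + 1` positive test points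
(`b ^ θ k`) at which its determinant is nonzero with alternating signs — the hypothesis shape of the graft law
`Census.Graft.exists_alternating_add`. [folklore] -/
theorem exists_alternating_of_symmDesign (d : Fin K → ℕ) (v ε : Fin m → Fin m → Fin K → ℤ)
    (hv : ∀ i j l, v i j l = v j i l) (hεs : ∀ i j l, ε i j l = ε j i l) (hε : ∀ i j l, (ε i j l).natAbs ≤ 1)
    {B : ℕ} (θ : Fin (B + 1) → ℤ) (hθ : StrictMono θ) (p : Fin (B + 1) → Equiv.Perm (Fin m) × (Fin m → Fin K))
    (hdom : ∀ k, IsDominant d v ε (θ k) (p k))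
    (halt : ∀ k : Fin B, termSign ε (p k.castSucc) * termSign ε (p k.succ) < 0) :
    ∃ (d' : Fin K → ℕ) (S : Fin K → Matrix (Fin m) (Fin m) ℝ) (τ : Fin (B + 1) → ℝ),
      (∀ l, (S l).IsSymm) ∧ StrictMono τ ∧ (∀ j, 0 < τ j) ∧ (∀ j, (∑ l, τ j ^ d' l • S l).det ≠ 0) ∧
      ∀ j : Fin B, (∑ l, τ j.castSucc ^ d' l • S l).det * (∑ l, τ j.succ ^ d' l • S l).det < 0 := by
  set b : ℝ := (Fintype.card (Equiv.Perm (Fin m) × (Fin m → Fin K)) : ℝ) + 1 with hbdef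
  have hb : (Fintype.card (Equiv.Perm (Fin m) × (Fin m → Fin K)) : ℝ) < b := by rw [hbdef]; linarith
  have hb1 : 1 < b := by
    have : (1 : ℝ) ≤ Fintype.card (Equiv.Perm (Fin m) × (Fin m → Fin K)) := by
      exact_mod_cast (Fintype.card_pos_iff.mpr ⟨p 0⟩ : 0 < Fintype.card (Equiv.Perm (Fin m) × (Fin m → Fin K)))
    linarith
  have hb0 : 0 < b := lt_trans zero_lt_one hb1
  refine ⟨d, patchMatrix b v ε, fun k => b ^ θ k, patchMatrix_isSymm b v ε hv hεs,
    fun i j hij => zpow_lt_zpow_right₀ hb1 (hθ hij), fun k => zpow_pos hb0 _, fun k => ?_, fun k => ?_⟩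
  · intro h0
    have hsgn := det_patch_sign b d v ε hε (θ k) (p k) (hdom k) hb
    rw [h0, mul_zero] at hsgn
    exact lt_irrefl 0 hsgn
  · exact det_patch_alternates b d v ε hε θ p hdom halt hb k

/-- **SYMMETRIC DESIGNS GRAFT.**  A SYMMETRIC design of format `(m, K)` with `B ≥ 1` alternations gives, for EVERY `j`,
`¬ PosRootLawAt m (K + j) (B + j·m − 1)`: some real symmetric `(K + j)`-term `m × m` lacunary pencil has at least `B + j·m` distinct
positive determinant zeros (the patchworked pencil of the design, grafted `j` times by `Census.Graft.exists_alternating_add`).  In census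
words: a symmetric tropical row `T_sym ≥ B` at `(m, K)` yields the RAY of real floors `ζ₊sym(m, K + j) ≥ B + j·m`.  `j = 0` is the
contrapositive of `symmDesign_le_of_posRootLawAt`. [folklore] -/
theorem not_posRootLawAt_add_of_symmDesign {B : ℕ} (hB : 1 ≤ B) (d : Fin K → ℕ) (v ε : Fin m → Fin m → Fin K → ℤ)
    (hv : ∀ i j l, v i j l = v j i l) (hεs : ∀ i j l, ε i j l = ε j i l) (hε : ∀ i j l, (ε i j l).natAbs ≤ 1)
    (θ : Fin (B + 1) → ℤ) (hθ : StrictMono θ) (p : Fin (B + 1) → Equiv.Perm (Fin m) × (Fin m → Fin K))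
    (hdom : ∀ k, IsDominant d v ε (θ k) (p k))
    (halt : ∀ k : Fin B, termSign ε (p k.castSucc) * termSign ε (p k.succ) < 0) (j : ℕ) :
    ¬ PosRootLawAt m (K + j) (B + j * m - 1) := by
  obtain ⟨d', S', τ', hS', hτ', hpos', -, halt'⟩ :=
    Census.Graft.exists_alternating_add (exists_alternating_of_symmDesign d v ε hv hεs hε θ hθ p hdom halt) j
  exact Census.Graft.not_posRootLawAt_of_alternating (hB.trans (Nat.le_add_right B (j * m))) d' S' hS' τ' hτ' hpos' halt'

/-- **SYMMETRIC DESIGNS GRAFT, row form.**  Same statement with the design packaged exactly as the tree's design theorems state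
their rows (`∃ d v ε, v symmetric ∧ ε symmetric ∧ |ε| ≤ 1 ∧ ∃ θ p, StrictMono θ ∧ dominant ∧ alternating`, `B + 1` terms):
for every `j`, `¬ PosRootLawAt m (K + j) (B + j·m − 1)`. [folklore] -/
theorem not_posRootLawAt_add_of_symmDesign_row {B : ℕ} (hB : 1 ≤ B)
    (h : ∃ (d : Fin K → ℕ) (v ε : Fin m → Fin m → Fin K → ℤ), (∀ i j l, v i j l = v j i l) ∧ (∀ i j l, ε i j l = ε j i l) ∧
      (∀ i j l, (ε i j l).natAbs ≤ 1) ∧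
      ∃ (θ : Fin (B + 1) → ℤ) (p : Fin (B + 1) → Equiv.Perm (Fin m) × (Fin m → Fin K)), StrictMono θ ∧
        (∀ k, IsDominant d v ε (θ k) (p k)) ∧ ∀ k : Fin B, termSign ε (p k.castSucc) * termSign ε (p k.succ) < 0)
    (j : ℕ) : ¬ PosRootLawAt m (K + j) (B + j * m - 1) := by
  obtain ⟨d, v, ε, hv, hεs, hε, θ, p, hθ, hdom, halt⟩ := h
  exact not_posRootLawAt_add_of_symmDesign hB d v ε hv hεs hε θ hθ p hdom halt j

/-- **Row form at the same format (`j = 0`)**: a symmetric design row with `B ≥ 1` alternations refutes `PosRootLawAt m K (B − 1)`,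
i.e. `ζ₊sym(m, K) ≥ B` (the contrapositive of `symmDesign_le_of_posRootLawAt`, packaged). [folklore] -/
theorem not_posRootLawAt_of_symmDesign_row {B : ℕ} (hB : 1 ≤ B)
    (h : ∃ (d : Fin K → ℕ) (v ε : Fin m → Fin m → Fin K → ℤ), (∀ i j l, v i j l = v j i l) ∧ (∀ i j l, ε i j l = ε j i l) ∧
      (∀ i j l, (ε i j l).natAbs ≤ 1) ∧
      ∃ (θ : Fin (B + 1) → ℤ) (p : Fin (B + 1) → Equiv.Perm (Fin m) × (Fin m → Fin K)), StrictMono θ ∧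
        (∀ k, IsDominant d v ε (θ k) (p k)) ∧ ∀ k : Fin B, termSign ε (p k.castSucc) * termSign ε (p k.succ) < 0) :
    ¬ PosRootLawAt m K (B - 1) := by
  simpa using not_posRootLawAt_add_of_symmDesign_row hB h 0

/-- **SYMMETRIC DESIGNS, BILINEAR (the quadrant).**  A SYMMETRIC design of format `(m, K + 1)` with `B ≥ 1` alternations gives,
for ALL `i, j`, `¬ PosRootLawAt (m + i) (K + 1 + j) (B + i·K + j·(m + i) − 1)`: the patchworked pencil of the design (an alternation
certificate, `exists_alternating_of_symmDesign`) bordered `i` times and grafted `j` times by `Census.Graft.not_posRootLawAt_bilinear`.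
In census words: a symmetric tropical row `T_sym ≥ B` at `(m, K + 1)` yields the QUADRANT of real floors
`ζ₊sym(m + i, K + 1 + j) ≥ B + i·K + j·(m + i)`.  `i = 0` is `not_posRootLawAt_add_of_symmDesign`. [folklore] -/
theorem not_posRootLawAt_bilinear_of_symmDesign {B : ℕ} (hB : 1 ≤ B) (d : Fin (K + 1) → ℕ)
    (v ε : Fin m → Fin m → Fin (K + 1) → ℤ)
    (hv : ∀ i j l, v i j l = v j i l) (hεs : ∀ i j l, ε i j l = ε j i l) (hε : ∀ i j l, (ε i j l).natAbs ≤ 1)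
    (θ : Fin (B + 1) → ℤ) (hθ : StrictMono θ) (p : Fin (B + 1) → Equiv.Perm (Fin m) × (Fin m → Fin (K + 1)))
    (hdom : ∀ k, IsDominant d v ε (θ k) (p k))
    (halt : ∀ k : Fin B, termSign ε (p k.castSucc) * termSign ε (p k.succ) < 0) (i j : ℕ) :
    ¬ PosRootLawAt (m + i) (K + 1 + j) (B + i * K + j * (m + i) - 1) := by
  obtain ⟨d', S', τ', hS', hτ', hpos', -, halt'⟩ := exists_alternating_of_symmDesign d v ε hv hεs hε θ hθ p hdom halt
  exact Census.Graft.not_posRootLawAt_bilinear hB d' S' hS' τ' hτ' hpos' halt' i j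

/-- **SYMMETRIC DESIGNS, BILINEAR, row form.**  Same statement with the design packaged as the tree's design theorems state their rows
(format `(m, K + 1)`, `B + 1` terms): for all `i, j`, `¬ PosRootLawAt (m + i) (K + 1 + j) (B + i·K + j·(m + i) − 1)`. [folklore] -/
theorem not_posRootLawAt_bilinear_of_symmDesign_row {B : ℕ} (hB : 1 ≤ B)
    (h : ∃ (d : Fin (K + 1) → ℕ) (v ε : Fin m → Fin m → Fin (K + 1) → ℤ), (∀ i j l, v i j l = v j i l) ∧
      (∀ i j l, ε i j l = ε j i l) ∧ (∀ i j l, (ε i j l).natAbs ≤ 1) ∧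
      ∃ (θ : Fin (B + 1) → ℤ) (p : Fin (B + 1) → Equiv.Perm (Fin m) × (Fin m → Fin (K + 1))), StrictMono θ ∧
        (∀ k, IsDominant d v ε (θ k) (p k)) ∧ ∀ k : Fin B, termSign ε (p k.castSucc) * termSign ε (p k.succ) < 0)
    (i j : ℕ) : ¬ PosRootLawAt (m + i) (K + 1 + j) (B + i * K + j * (m + i) - 1) := by
  obtain ⟨d, v, ε, hv, hεs, hε, θ, p, hθ, hdom, halt⟩ := h
  exact not_posRootLawAt_bilinear_of_symmDesign hB d v ε hv hεs hε θ hθ p hdom halt i j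

end Summit.ValiantsHypothesis.ValiantsHypothesis.Theorems.LacunarySymmetroidMatrixDescartes.TropicalCensus
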